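import Summits.Parity.GeneralizedHardyLittlewood.Theorems.GreenTaoLevelTwoMNTwoBohrGauge

/-!
# Route `GreenTaoLevelTwo`, crux `MNTwo` (stmt-Parity-21276), line `birth`, stub `stub_mnVertical`:
# Proposition 22 at one scale in the type II case, from Lemma 24 (GT 2008b §10, end)

Block H4 / R4-II of the `stub_mnVertical` census (B. Green, T. Tao, *Quadratic uniformity of the
Möbius function*, Ann. Inst. Fourier 58 (2008) = arXiv:math/0606087, §10: "It remains to use this
lemma to complete the proof of Proposition 22 in the Type II case. We take `𝒟` to be simply the
whole interval `[D/2X^{1/2}, D/X^{1/2}]` … In Lemma 24 take `L = M := εX^{1/2}/10` and `s := d`,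
`t := w`").  Def-free and purely combinatorial: the conclusion of Lemma 24 (Type II sum implies
major arc) is taken as the hypothesis `hL24` in its printed two-parameter form — for `s, t ∈ ℤ`,
`L, M ∈ ℕ` with `L|s| ≤ c_D`, `M|t| ≤ c_W`, `L, M ≥ ℓ₀` and `L·M·ν(st) ≤ c_ν` some `1 ≤ q ≤ Q` has
`‖q•φ''(st,st)‖ ≤ M₀/(L²M²)` — with FREE side-condition constants `c_D, c_W, ℓ₀, c_ν` (to be
instantiated by the Lemma-24 assembly, e.g. `εD, εW, 1/ε, ε²`), for the rotation Bohr gauge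
`ν(n) = maxᵢ‖nαᵢ‖ + |n|/N` of `…MNTwoBohrGauge`.  Given a level `D ≥ 1` (in the application
`D ≈ K√ρ₁`) and a common length `ℓ = L = M ≥ 1` (in the application `ℓ ≈ ε/(10√ρ₁)`) satisfying
the explicit compatibility inequalities `hℓD`, `hℓW`, `hℓ₀`, `hℓν`, the budget conditions `Q ≤ P`,
`M₀ ≤ Pρ₁²ℓ⁴`, `4ρ₁ ≤ P` and the Prop-25 size condition, the conclusion of Proposition 22 holds at
the scale `ρ₁` with budget `P` — exactly the shape of the hypothesis `hP22` of
`…MNTwoMajorArcOfPropTwentyTwo.majorArc_of_prop22` / "Prop. 22 at the budget scale" of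
`…MNTwoInverseOfPropTwentyTwo` — with `𝒟 = [⌈D/2⌉, D]` (all integers: `#𝒟 ≥ D/2`).

* `two_mul_card_Icc_half_ge` — `D ≤ 2·#[⌈D/2⌉, D]`;
* `prop22_of_typeII_core` — the statement just described.

References: [GreenTao2008QuadraticMobius] arXiv:math/0606087 §10 (end of the type II case),
Lemma 24.
-/

noncomputable section

open Finset Real

namespace Summit.Parity.GeneralizedHardyLittlewood.GreenTaoLevelTwoMNTwoTypeIIBranch

open Summit.Parity.GeneralizedHardyLittlewood.GreenTaoLevelTwoMNTwoBohrGauge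
  (bohrGauge_nonneg bohrGauge_lt_iff abs_le_mul_bohrGauge iSup_norm_nonneg)

/-- The upper half `[⌈D/2⌉, D] = [(D+1)/2, D]` of `[1, D]` has at least `D/2` elements:
`D ≤ 2·#[(D+1)/2, D]`. [folklore] -/
theorem two_mul_card_Icc_half_ge (D : ℕ) : D ≤ 2 * #(Icc ((D + 1) / 2) D) := by
  rw [Nat.card_Icc]
  omega

/-- **Proposition 22 at one scale, type II case, from Lemma 24 (GT 2008b §10).**  Let
`ν(n) = maxᵢ‖nαᵢ‖ + |n|/N` (`N ≥ 1`), `φ : ℤ → ℝ/ℤ`, and suppose the conclusion of Lemma 24 in the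
form `hL24` (module docstring) with constants `Q, M₀, c_D, c_W, ℓ₀, c_ν`.  Let `D ≥ 1`, `ℓ ≥ 1`,
`0 < ρ₁` and `P` satisfy `ℓD ≤ c_D`, `ℓ·2Nρ₁ ≤ c_W·D`, `ℓ₀ ≤ ℓ`, `ℓ²ρ₁ ≤ c_ν`, `Q ≤ P`,
`M₀ ≤ Pρ₁²ℓ⁴`, `4ρ₁ ≤ P` and `4·32·38ᵏD ≤ (ρ₁/16)^{k+1}N/2`.  Then with `𝒟 = [⌈D/2⌉, D]`:
`𝒟 ⊆ [1,D]`, `ρ₁D²/P ≤ #𝒟²`, and every multiple `n ∈ B(ρ₁)` of every `d ∈ 𝒟` (`n = dw`: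
apply `hL24` with `s = d`, `t = w`, `L = M = ℓ`) has `1 ≤ q ≤ P` with `‖q•φ''(n,n)‖ ≤ Pρ₁²`.
[cite: GreenTao2008QuadraticMobius, §10 (end of the type II case, "take `𝒟` to be the whole
interval"), Lemma 24] -/
theorem prop22_of_typeII_core (k : ℕ) {N : ℕ} (hN : 1 ≤ N) (α : Fin k → ℝ) (n₀ : ℤ)
    (φ : ℤ → UnitAddCircle) {D ℓ : ℕ} (hD : 1 ≤ D) (hℓ : 1 ≤ ℓ)
    {Q M₀ cD cW ℓ₀ cν P ρ₁ : ℝ} (hρ₁ : 0 < ρ₁)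
    (hL24 : ∀ (s t : ℤ) (L M : ℕ), (L : ℝ) * |(s : ℝ)| ≤ cD → (M : ℝ) * |(t : ℝ)| ≤ cW →
      ℓ₀ ≤ (L : ℝ) → ℓ₀ ≤ (M : ℝ) →
      (L : ℝ) * (M : ℝ) *
          ((⨆ i : Fin k, ‖((((s * t : ℤ) : ℝ) * α i : ℝ) : AddCircle (1 : ℝ))‖) +
            |((s * t : ℤ) : ℝ)| / N) ≤ cν →
      ∃ q : ℕ, 1 ≤ q ∧ (q : ℝ) ≤ Q ∧
        ‖q • (φ (n₀ + s * t + s * t) - φ (n₀ + s * t) - φ (n₀ + s * t) + φ n₀)‖ ≤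
          M₀ / ((L : ℝ) ^ 2 * (M : ℝ) ^ 2))
    (hℓD : (ℓ : ℝ) * D ≤ cD) (hℓW : (ℓ : ℝ) * (2 * N * ρ₁) ≤ cW * D) (hℓ₀ : ℓ₀ ≤ (ℓ : ℝ))
    (hℓν : (ℓ : ℝ) ^ 2 * ρ₁ ≤ cν) (hQP : Q ≤ P) (hM₀ : M₀ ≤ P * ρ₁ ^ 2 * (ℓ : ℝ) ^ 4)
    (hdens : 4 * ρ₁ ≤ P)
    (hsize : 4 * (32 * 38 ^ k) * (D : ℝ) ≤ (ρ₁ / 16) ^ (k + 1) * N / 2) :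
    ∃ (D' : ℕ) (𝒟 : Finset ℕ), 1 ≤ D' ∧ 𝒟 ⊆ Icc 1 D' ∧
      4 * (32 * 38 ^ k) * (D' : ℝ) ≤ (ρ₁ / 16) ^ (k + 1) * N / 2 ∧
      ρ₁ * (D' : ℝ) ^ 2 / P ≤ (#𝒟 : ℝ) ^ 2 ∧
      ∀ d ∈ 𝒟, ∀ n ∈ (Finset.Ioo (-(N : ℤ)) N).filter fun n : ℤ =>
          (∀ i, ‖(((n : ℝ) * α i : ℝ) : AddCircle (1 : ℝ))‖ + |(n : ℝ)| / N < ρ₁) ∧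
            |(n : ℝ)| / N < ρ₁,
        (d : ℤ) ∣ n → ∃ q : ℕ, 1 ≤ q ∧ (q : ℝ) ≤ P ∧
          ‖((q : ℤ)) • (φ (n₀ + n + n) - φ (n₀ + n) - φ (n₀ + n) + φ n₀)‖ ≤ P * ρ₁ ^ 2 := by
  classical
  have hNr : (0 : ℝ) < N := by exact_mod_cast hN
  have hDr : (0 : ℝ) < D := by exact_mod_cast hD
  have hℓr : (1 : ℝ) ≤ ℓ := by exact_mod_cast hℓ
  have hP0 : 0 < P := lt_of_lt_of_le (by positivity) hdens
  refine ⟨D, Icc ((D + 1) / 2) D, hD, ?_, hsize, ?_, ?_⟩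
  · -- `𝒟 ⊆ [1, D]`
    intro d hd
    rw [mem_Icc] at hd ⊢
    omega
  · -- density: `ρ₁D²/P ≤ (D/2)² ≤ #𝒟²`
    have hcard : (D : ℝ) ≤ 2 * (#(Icc ((D + 1) / 2) D) : ℝ) := by
      exact_mod_cast two_mul_card_Icc_half_ge D
    have h1 : ρ₁ * (D : ℝ) ^ 2 / P ≤ (D : ℝ) ^ 2 / 4 := by
      rw [div_le_div_iff₀ hP0 (by norm_num : (0 : ℝ) < 4)]
      have : 0 ≤ (D : ℝ) ^ 2 := by positivity
      nlinarith
    refine h1.trans ?_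
    have h2 : ((D : ℝ) / 2) ^ 2 ≤ (#(Icc ((D + 1) / 2) D) : ℝ) ^ 2 :=
      pow_le_pow_left₀ (by positivity) (by linarith) 2
    calc (D : ℝ) ^ 2 / 4 = ((D : ℝ) / 2) ^ 2 := by ring
      _ ≤ _ := h2
  · -- the main clause
    intro d hd n hn hdn
    rw [mem_Icc] at hd
    have hd2 : D ≤ 2 * d := by omega
    have hd1 : 1 ≤ d := by omega
    have hdr : (0 : ℝ) < d := by exact_mod_cast hd1
    have hdD : (d : ℝ) ≤ D := by exact_mod_cast hd.2
    have hd2r : (D : ℝ) ≤ 2 * d := by exact_mod_cast hd2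
    rw [mem_filter] at hn
    have hνn : (⨆ i : Fin k, ‖(((n : ℝ) * α i : ℝ) : AddCircle (1 : ℝ))‖) + |(n : ℝ)| / N < ρ₁ :=
      (bohrGauge_lt_iff α N n ρ₁).2 hn.2
    have hnabs : |(n : ℝ)| ≤ N * ρ₁ :=
      (abs_le_mul_bohrGauge α hN n).trans (mul_le_mul_of_nonneg_left hνn.le hNr.le)
    obtain ⟨w, rfl⟩ := hdn
    -- the side conditions of Lemma 24 for `s = d`, `t = w`, `L = M = ℓ`
    have hs : (ℓ : ℝ) * |(((d : ℕ) : ℤ) : ℝ)| ≤ cD := by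
      rw [Int.cast_natCast, Nat.abs_cast]
      exact (mul_le_mul_of_nonneg_left hdD (by positivity)).trans hℓD
    have hw : |(w : ℝ)| ≤ 2 * N * ρ₁ / D := by
      have h1 : (d : ℝ) * |(w : ℝ)| ≤ N * ρ₁ := by
        have e : |((((d : ℕ) : ℤ) * w : ℤ) : ℝ)| = (d : ℝ) * |(w : ℝ)| := by
          push_cast
          rw [abs_mul, Nat.abs_cast]
        rw [← e]; exact hnabs
      rw [le_div_iff₀ hDr]
      calc |(w : ℝ)| * D ≤ |(w : ℝ)| * (2 * d) := mul_le_mul_of_nonneg_left hd2r (abs_nonneg _)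
        _ = 2 * ((d : ℝ) * |(w : ℝ)|) := by ring
        _ ≤ 2 * (N * ρ₁) := by linarith
        _ = 2 * N * ρ₁ := by ring
    have ht : (ℓ : ℝ) * |(w : ℝ)| ≤ cW := by
      have h1 : (ℓ : ℝ) * |(w : ℝ)| ≤ (ℓ : ℝ) * (2 * N * ρ₁ / D) :=
        mul_le_mul_of_nonneg_left hw (by positivity)
      refine h1.trans ?_
      rw [mul_div_assoc', div_le_iff₀ hDr]
      exact hℓW
    have hν : (ℓ : ℝ) * (ℓ : ℝ) *
        ((⨆ i : Fin k, ‖(((((((d : ℕ) : ℤ) * w : ℤ)) : ℝ) * α i : ℝ) : AddCircle (1 : ℝ))‖) +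
          |(((((d : ℕ) : ℤ) * w : ℤ)) : ℝ)| / N) ≤ cν := by
      have h0 := bohrGauge_nonneg α N (((d : ℕ) : ℤ) * w)
      calc (ℓ : ℝ) * (ℓ : ℝ) *
            ((⨆ i : Fin k, ‖(((((((d : ℕ) : ℤ) * w : ℤ)) : ℝ) * α i : ℝ) : AddCircle (1 : ℝ))‖) +
              |(((((d : ℕ) : ℤ) * w : ℤ)) : ℝ)| / N)
          ≤ (ℓ : ℝ) * (ℓ : ℝ) * ρ₁ := mul_le_mul_of_nonneg_left hνn.le (by positivity)
        _ = (ℓ : ℝ) ^ 2 * ρ₁ := by ring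
        _ ≤ cν := hℓν
    obtain ⟨q, hq1, hqQ, hqb⟩ := hL24 ((d : ℕ) : ℤ) w ℓ ℓ hs ht hℓ₀ hℓ₀ hν
    refine ⟨q, hq1, hqQ.trans hQP, ?_⟩
    rw [natCast_zsmul]
    refine hqb.trans ?_
    have hℓ4 : (0 : ℝ) < (ℓ : ℝ) ^ 2 * (ℓ : ℝ) ^ 2 := by positivity
    rw [div_le_iff₀ hℓ4]
    calc M₀ ≤ P * ρ₁ ^ 2 * (ℓ : ℝ) ^ 4 := hM₀
      _ = P * ρ₁ ^ 2 * ((ℓ : ℝ) ^ 2 * (ℓ : ℝ) ^ 2) := by ring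

end Summit.Parity.GeneralizedHardyLittlewood.GreenTaoLevelTwoMNTwoTypeIIBranch
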